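import Literature.NumberTheory.EllipticCurves.KatoTwistedFinitenessProofs
import Literature.NumberTheory.EllipticCurves.KatoTwistedFinitenessTrivialCharacterProofs
import Literature.NumberTheory.EllipticCurves.LFunctionCoefficientBound
import HarnessLib

/-!
# Kato's hypothesis `L(E, χ, 1) ≠ 0` does not depend on the removed Euler factors

K. Kato, *`p`-adic Hodge theory and values of zeta functions of modular forms*, Astérisque 295
(2004), Cor. 14.3 (p. 235), assumes `L(A, χ, 1) ≠ 0`, where (remark after Thm. 14.2, p. 235, and
§6.2, p. 161) `L(f, χ, s)` MEANS the imprimitive series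
`L_S(f, χ, s) = ∑_{(n,S)=1} aₙ(f) χ(n) n⁻ˢ` with `S = prime(m)` for the least `m` with
`K ⊂ ℚ(ζ_m)`. The tree vendors part (2) of the corollary for `A = E` an elliptic curve over `ℚ`
and `K = ℚ(ζ_m)` as the named fact `kato_finite_chiPart_of_twistedLValue_ne_zero`
(`KatoTwistedFiniteness.lean`, `m ≢ 2 (mod 4)`; all moduli by
`kato_finite_chiPart_cyclotomic_of_twistedLValue_ne_zero_of`, `KatoTwistedFinitenessProofs.lean`),
with the hypothesis spelled through an entire continuation of the mod-`m` series
`twistedLSeries f χ s = ∑ χ(n) aₙ(f) n⁻ˢ` (`re s > 2`), i.e. of `L_{prime(m)}(f, χ, s)`.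

Consumers, however, hold non-vanishing results for PRIMITIVE twisted `L`-values `L(f ⊗ χ₀, 1)`
(`χ₀` the primitive character inducing `χ`), or for the series at some other level. This file
proves that all these hypotheses are the same: for a Dirichlet character `χ` mod `m` and its
inflation `χ̃ = changeLevel χ` mod `M` (`m ∣ M`),

* `twistedLSeries_changeLevel_eq_prod_mul` — on `re s > 2`,
  `L(f, χ̃, s) = ∏_{p ∣ M, p ∤ m} (1 − χ(p) a_p p⁻ˢ + 𝟙_N(p) χ(p)² p · p⁻²ˢ) · L(f, χ, s)`
  for a newform `f ∈ S₂(Γ₀(N))` (Hecke's relation `a_{pn} = a_p aₙ − 𝟙_N(p) p a_{n/p}`,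
  Diamond–Shurman Prop. 5.8.5, fed to the tree's `LSeries_indicator_coprime_eq`; Shimura 1971,
  Thm. 3.66; Kato §6.2);
* `eulerFactor_one_ne_zero` — **the removed Euler factors do not vanish at `s = 1`** when `f` is
  the newform of an elliptic curve `E/ℚ` (`IsNewformOf W f`): for a prime `p` and `|c| = 1`,
  `1 − c a_p(E)/p + 𝟙_N(p) c²/p ≠ 0`. For `p ∤ N` a zero forces `a_p = p c̄ + c` with `a_p ∈ ℤ`,
  hence `c = ±1` and `|a_p| = p + 1`, against the bound `|a_p(E)| ≤ 2√p` valid at EVERY prime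
  for Mathlib's `WeierstrassCurve.LFunction` (tree theorem `abs_LFunction_prime_pow_le`, from
  Hasse's theorem, proved in the tree); for `p ∣ N` a zero forces `|a_p| = p`, but
  `a_{p^6}(f) = a_p(f)^6` (`U_p`-recursion at a prime dividing the level) while
  `|a_{p^6}(E)| ≤ 7 p³ < p⁶`;
* `exists_continuation_changeLevel_iff` — hence (identity theorem) an entire continuation of the
  mod-`M` series of `χ̃` is non-zero at `1` iff one (equivalently every) entire continuation of
  the mod-`m` series of `χ` is; in particular (`changeLevel_primitiveCharacter`) iff the primitive
  twisted `L`-value `L(f ⊗ χ₀, 1)` is non-zero (`exists_continuation_iff_primitive`);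
* `kato_finite_chiPart_of_twistedLValue_ne_zero_of_dvd`,
  `kato_finite_chiPart_of_primitive_twistedLValue_ne_zero` — the consumer forms of Kato's
  Cor. 14.3 (2): GIVEN the vendored fact (hypothesis `hK`, not proved here), for every `M ≥ 1`
  and every Dirichlet character `χ̃` mod `M` induced from `χ` mod `m ∣ M` (e.g. from its primitive
  character), non-vanishing at `1` of the continuation of the LOWER-level series already kills
  `E(ℚ(ζ_M))^(χ̃)`. This is Kato's convention "`S = prime(m)` for the least `m`" (p. 235) made
  harmless: any finite `S` containing the primes of the conductor gives the same hypothesis.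

Everything here is a theorem; no definition, no named fact. Kato's theorem itself (the Euler
system argument, §§8–14) is NOT proved here: `kato_finite_chiPart_of_twistedLValue_ne_zero`
stays literature debt and enters only as the hypothesis `hK` of the last section.

## References

* K. Kato, *`p`-adic Hodge theory and values of zeta functions of modular forms*, Astérisque 295
  (2004), 117–290: §6.2 (p. 161), Thm. 14.2 and Cor. 14.3 (p. 235). [Kato2004Asterisque]
* G. Shimura, *Introduction to the Arithmetic Theory of Automorphic Functions* (1971), Thm. 3.66.
  [Shimura1971]
* F. Diamond, J. Shurman, *A First Course in Modular Forms*, GTM 228 (2005), Prop. 5.8.5,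
  §8.8 (8.44). [DiamondShurman2005]
* J. H. Silverman, *The Arithmetic of Elliptic Curves*, 2nd ed. (2009), Thm. V.1.1 (Hasse).
  [SilvermanAEC2009]
-/

noncomputable section

open scoped BigOperators

open WeierstrassCurve WeierstrassCurve.Affine CongruenceSubgroup Complex

namespace Literature.NumberTheory.EllipticCurves

/-! ## 1. Induced Dirichlet characters as functions on `ℕ` -/

section ChangeLevel

variable {R : Type*} [CommMonoidWithZero R] {m M : ℕ}

/-- The inflation `χ̃ = changeLevel χ` mod `M` of a Dirichlet character `χ` mod `m ∣ M` is, on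
natural numbers, `χ̃(n) = χ(n)` if `(n, M) = 1` and `χ̃(n) = 0` otherwise (Mathlib
`changeLevel_eq_cast_of_dvd`, `MulChar.map_nonunit`). [folklore] -/
theorem changeLevel_apply_natCast (hd : m ∣ M) (χ : DirichletCharacter R m) (n : ℕ) :
    DirichletCharacter.changeLevel hd χ (n : ZMod M) =
      if n.Coprime M then χ (n : ZMod m) else 0 := by
  by_cases hn : n.Coprime M
  · rw [if_pos hn]
    have hu : IsUnit (n : ZMod M) := (ZMod.isUnit_iff_coprime n M).mpr hn
    rw [← hu.unit_spec, DirichletCharacter.changeLevel_eq_cast_of_dvd χ hd hu.unit, hu.unit_spec,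
      ZMod.cast_natCast hd]
  · rw [if_neg hn]
    exact MulChar.map_nonunit _ (mt (ZMod.isUnit_iff_coprime n M).mp hn)

/-- A Dirichlet character mod `m` vanishes at the integers not prime to `m`. [folklore] -/
theorem dirichletCharacter_apply_natCast_of_not_coprime {m : ℕ} (χ : DirichletCharacter R m)
    {n : ℕ} (hn : ¬ n.Coprime m) : χ (n : ZMod m) = 0 :=
  MulChar.map_nonunit _ (mt (ZMod.isUnit_iff_coprime n m).mp hn)

/-- `χ̃(n) aₙ`, for the inflation `χ̃` mod `M` of `χ` mod `m ∣ M`, is `χ(n) aₙ` deprived of the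
integers divisible by a prime of `M` not dividing `m` (the primes of `M` dividing `m` are already
killed by `χ`). [folklore] -/
theorem changeLevel_mul_eq_indicator [NeZero M] (hd : m ∣ M) (χ : DirichletCharacter R m)
    (a : ℕ → R) :
    (fun n : ℕ ↦ DirichletCharacter.changeLevel hd χ (n : ZMod M) * a n) =
      fun n ↦ if ∀ p ∈ M.primeFactors.filter (fun p => ¬ p ∣ m), ¬ p ∣ n
        then χ (n : ZMod m) * a n else 0 := by
  funext n
  rw [changeLevel_apply_natCast hd χ n]
  by_cases hn : n.Coprime M
  · rw [if_pos hn, if_pos]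
    intro p hp hpn
    have hp' := Nat.mem_primeFactors.mp (Finset.mem_filter.mp hp).1
    exact (Nat.Prime.one_lt hp'.1).ne' (Nat.eq_one_of_dvd_coprimes hn hpn hp'.2.1)
  · rw [if_neg hn, zero_mul]
    by_cases hall : ∀ p ∈ M.primeFactors.filter (fun p => ¬ p ∣ m), ¬ p ∣ n
    · rw [if_pos hall]
      -- then `n` is not prime to `m` either, so `χ n = 0`
      have hnm : ¬ n.Coprime m := by
        intro hcop
        apply hn
        refine Nat.coprime_of_dvd fun p hp hpn hpM => ?_
        by_cases hpm : p ∣ m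
        · exact (Nat.Prime.one_lt hp).ne' (Nat.eq_one_of_dvd_coprimes hcop hpn hpm)
        · exact hall p (Finset.mem_filter.mpr ⟨Nat.mem_primeFactors.mpr ⟨hp, hpM, NeZero.ne M⟩,
            hpm⟩) hpn
      rw [dirichletCharacter_apply_natCast_of_not_coprime χ hnm, zero_mul]
    · rw [if_neg hall]

end ChangeLevel

/-! ## 2. `L(f, χ̃, s) = ∏_{p ∣ M, p ∤ m} (Euler factor at p) · L(f, χ, s)` -/

section EulerProduct

open LSeries ModularForms

variable {N : ℕ} [NeZero N] {m M : ℕ} [NeZero M]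

/-- Hecke's relation for the twisted coefficients `χ(n) aₙ(f)` at a prime `p ∤ m`:
`χ(pn) a_{pn} = (χ(p) a_p) (χ(n) aₙ) − 𝟙_N(p) p χ(p)² 𝟙_{p∣n} χ(n/p) a_{n/p}` (`χ` is completely
multiplicative on `ℕ`; Diamond–Shurman Prop. 5.8.5). [cite: DiamondShurman2005, Prop. 5.8.5] -/
theorem twistedCoeff_prime_mul {f : CuspForm (Gamma0 N) 2} (hf : IsNewform0 f)
    (χ : DirichletCharacter ℂ m) {p : ℕ} (hp : p.Prime) (n : ℕ) :
    χ ((p * n : ℕ) : ZMod m) * cuspCoeff f (p * n) =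
      (χ (p : ZMod m) * cuspCoeff f p) * (χ (n : ZMod m) * cuspCoeff f n) -
        ((if p ∣ N then 0 else (p : ℂ)) * χ (p : ZMod m) ^ 2) *
          (if p ∣ n then χ ((n / p : ℕ) : ZMod m) * cuspCoeff f (n / p) else 0) := by
  rw [hf.cuspCoeff_prime_mul_weight_two hp n]
  by_cases hpn : p ∣ n
  · obtain ⟨k, rfl⟩ := hpn
    rw [if_pos (dvd_mul_right p k), if_pos (dvd_mul_right p k),
      Nat.mul_div_cancel_left k hp.pos]
    push_cast
    simp only [map_mul]
    ring
  · rw [if_neg hpn, if_neg hpn]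
    push_cast
    simp only [map_mul]
    ring

/-- **Removing the Euler factors at the primes of `M` not dividing `m`** (Kato, Astérisque 295,
§6.2, p. 161: `L_S(f, χ, s) = ∑_{(n,S)=1} aₙ χ(n) n⁻ˢ`; Shimura 1971, Thm. 3.66). For a newform
`f ∈ S₂(Γ₀(N))`, a Dirichlet character `χ` mod `m`, its inflation `χ̃ = changeLevel χ` mod `M`
(`m ∣ M`) and `re s > 2`:
`∑ χ̃(n) aₙ n⁻ˢ = ∏_{p ∣ M, p ∤ m} (1 − χ(p) a_p p⁻ˢ + 𝟙_N(p) χ(p)² p · p⁻²ˢ) · ∑ χ(n) aₙ n⁻ˢ`,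
where `𝟙_N(p) = 0` for `p ∣ N` and `1` otherwise. [cite: Kato2004Asterisque, §6.2 (p. 161)] -/
theorem twistedLSeries_changeLevel_eq_prod_mul {f : CuspForm (Gamma0 N) 2} (hf : IsNewform0 f)
    (hd : m ∣ M) (χ : DirichletCharacter ℂ m) {s : ℂ} (hs : 2 < s.re) :
    twistedLSeries f (DirichletCharacter.changeLevel hd χ) s =
      (∏ p ∈ M.primeFactors.filter (fun p => ¬ p ∣ m),
        (1 - χ (p : ZMod m) * cuspCoeff f p * (p : ℂ) ^ (-s) +
          (if p ∣ N then 0 else (p : ℂ)) * χ (p : ZMod m) ^ 2 * ((p : ℂ) ^ (-s)) ^ 2)) *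
      twistedLSeries f χ s := by
  rw [twistedLSeries, twistedLSeries, changeLevel_mul_eq_indicator hd χ (cuspCoeff f)]
  exact LSeries_indicator_coprime_eq (a := fun n ↦ χ (n : ZMod m) * cuspCoeff f n)
    (ap := fun p ↦ χ (p : ZMod m) * cuspCoeff f p)
    (e := fun p ↦ (if p ∣ N then 0 else (p : ℂ)) * χ (p : ZMod m) ^ 2)
    (M.primeFactors.filter fun p => ¬ p ∣ m)
    (fun p hp => Nat.prime_of_mem_primeFactors (Finset.mem_filter.mp hp).1)
    (fun p hp n => twistedCoeff_prime_mul hf χ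
      (Nat.prime_of_mem_primeFactors (Finset.mem_filter.mp hp).1) n)
    (LSeriesSummable_dirichlet_mul_cuspCoeff f χ hs)

end EulerProduct

/-! ## 3. The removed Euler factors do not vanish at `s = 1` -/

section Nonvanishing

open ModularForms

variable {N : ℕ} [NeZero N]

/-- **`U_p`-recursion at a prime dividing the level**: for a newform `f ∈ S_k(Γ₀(N))` and a
prime `p ∣ N`, `a_{p^j}(f) = a_p(f)^j` for all `j` (Hecke's relation
`a_{pn} = a_p aₙ − 𝟙_N(p) p^{k-1} a_{n/p}` with `𝟙_N(p) = 0`, and `a_1 = 1`; Diamond–Shurman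
Prop. 5.8.5, Atkin–Lehner 1970, Thm. 3). [cite: DiamondShurman2005, Prop. 5.8.5] -/
theorem ModularForms.IsNewform0.cuspCoeff_prime_pow_of_dvd_level {k : ℤ}
    {f : CuspForm (Gamma0 N) k} (hf : IsNewform0 f) {p : ℕ} (hp : p.Prime) (hpN : p ∣ N)
    (j : ℕ) : cuspCoeff f (p ^ j) = cuspCoeff f p ^ j := by
  induction j with
  | zero =>
    rw [pow_zero, pow_zero]
    exact (isNormalized_iff_cuspCoeff_one f).mp hf.2.2
  | succ j ih =>
    rw [pow_succ, mul_comm (p ^ j) p, hf.cuspCoeff_prime_mul hp (p ^ j), if_pos hpN, sub_zero, ih]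
    ring

/-- **Hasse at every prime, squared**: `a_p(E)² ≤ 4p` for the `p`-th coefficient of Mathlib's
`WeierstrassCurve.LFunction` of an elliptic curve `E/ℚ` and every prime `p` (good or bad), from
the tree's `abs_LFunction_prime_pow_le` (`|a_{p^k}| ≤ (k + 1) p^{k/2}`, Hasse's theorem for the
reduction of a minimal model; Silverman AEC V.1.1). [cite: SilvermanAEC2009, Thm. V.1.1] -/
theorem sq_LFunction_prime_le (W : WeierstrassCurve ℚ) [W.IsElliptic] {p : ℕ} (hp : p.Prime) :
    ((W.LFunction p : ℤ) : ℝ) ^ 2 ≤ 4 * p := by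
  have h := W.abs_LFunction_prime_pow_le hp 1
  rw [pow_one, pow_one] at h
  norm_num at h
  have h0 : 0 ≤ Real.sqrt p := Real.sqrt_nonneg _
  have h1 : |((W.LFunction p : ℤ) : ℝ)| ^ 2 ≤ (2 * Real.sqrt p) ^ 2 :=
    pow_le_pow_left₀ (abs_nonneg _) h 2
  rw [sq_abs, mul_pow, Real.sq_sqrt (Nat.cast_nonneg p)] at h1
  linarith

/-- **At a prime dividing the level, `|a_p(E)| < p`.** If `f ∈ S₂(Γ₀(N))` is the newform of the
elliptic curve `E/ℚ` (`IsNewformOf W f`) and `p ∣ N`, then `|a_p| < p`: otherwise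
`|a_{p^6}(E)| = |a_p(f)^6| ≥ p^6` (`U_p`-recursion, `cuspCoeff_prime_pow_of_dvd_level`) while
`|a_{p^6}(E)| ≤ 7 p^3` (`abs_LFunction_prime_pow_le`). (In truth `a_p ∈ {0, ±1}` there, `N` being
the conductor by Carayol's theorem; this weak bound avoids it.) [folklore] -/
theorem abs_LFunction_prime_lt_of_dvd_level {W : WeierstrassCurve ℚ} [W.IsElliptic]
    {f : CuspForm (Gamma0 N) 2} (hf : IsNewformOf W f) {p : ℕ} (hp : p.Prime) (hpN : p ∣ N) :
    |((W.LFunction p : ℤ) : ℝ)| < p := by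
  by_contra hle
  push Not at hle
  have hp2 : (2 : ℝ) ≤ p := by exact_mod_cast hp.two_le
  -- `a_{p^6}(E) = a_p(E)^6` in `ℤ`
  have h6 : W.LFunction (p ^ 6) = W.LFunction p ^ 6 := by
    have h := hf.1.cuspCoeff_prime_pow_of_dvd_level hp hpN 6
    rw [hf.2 (p ^ 6), hf.2 p] at h
    exact_mod_cast h
  have hb := W.abs_LFunction_prime_pow_le hp 6
  rw [h6] at hb
  have hs6 : Real.sqrt p ^ 6 = (p : ℝ) ^ 3 := by
    rw [show (6 : ℕ) = 2 * 3 by norm_num, pow_mul, Real.sq_sqrt (Nat.cast_nonneg p)]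
  rw [hs6, Int.cast_pow, abs_pow] at hb
  norm_num at hb
  -- `p^6 ≤ |a_p|^6 ≤ 7 p^3`
  have h1 : (p : ℝ) ^ 6 ≤ |((W.LFunction p : ℤ) : ℝ)| ^ 6 :=
    pow_le_pow_left₀ (Nat.cast_nonneg p) hle 6
  have h2 : (p : ℝ) ^ 6 ≤ 7 * (p : ℝ) ^ 3 := h1.trans hb
  have h3 : (8 : ℝ) ≤ (p : ℝ) ^ 3 := by
    have h := pow_le_pow_left₀ (by norm_num) hp2 3
    norm_num at h
    exact h
  nlinarith [h2, h3, pow_pos (show (0 : ℝ) < p by linarith) 3]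

/-- **The Euler factors removed from `L(f, χ, s)` do not vanish at `s = 1`.** Let `f ∈ S₂(Γ₀(N))`
be the newform of the elliptic curve `E/ℚ` (`IsNewformOf W f`), `p` a prime and `c ∈ ℂ` with
`|c| = 1` (the value `χ(p)` of a Dirichlet character at a prime not dividing its modulus). Then
`1 − c a_p p⁻¹ + 𝟙_N(p) c² p · p⁻² ≠ 0`. For `p ∤ N`: a zero gives `p − c a_p + c² = 0`, whose
imaginary part is `Im(c) (2 Re(c) − a_p) = 0`; `Im c = 0` forces `c = ±1` and `|a_p| = p + 1`,
`a_p = 2 Re c` forces `p = |c|² = 1` — both absurd as `a_p² ≤ 4p` (Hasse) and `p ≥ 2`. For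
`p ∣ N`: a zero gives `c a_p = p`, `|a_p| = p`, against `abs_LFunction_prime_lt_of_dvd_level`.
(Kato, Astérisque 295, p. 235, works with `L_S` for the least `S`; this lemma is what makes the
choice of `S` immaterial at `s = 1`.) [folklore] -/
theorem eulerFactor_one_ne_zero {W : WeierstrassCurve ℚ} [W.IsElliptic]
    {f : CuspForm (Gamma0 N) 2} (hf : IsNewformOf W f) {p : ℕ} (hp : p.Prime) {c : ℂ}
    (hc : ‖c‖ = 1) :
    1 - c * cuspCoeff f p * (p : ℂ)⁻¹ +
      (if p ∣ N then 0 else (p : ℂ)) * c ^ 2 * ((p : ℂ)⁻¹) ^ 2 ≠ 0 := by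
  set a : ℤ := W.LFunction p with ha
  have hap : cuspCoeff f p = (a : ℂ) := hf.2 p
  have hp0 : (p : ℂ) ≠ 0 := Nat.cast_ne_zero.mpr hp.ne_zero
  have hp2 : (2 : ℝ) ≤ p := by exact_mod_cast hp.two_le
  have ha2 : (a : ℝ) ^ 2 ≤ 4 * p := sq_LFunction_prime_le W hp
  -- `c = x + iy` with `x² + y² = 1`
  have hxy : c.re ^ 2 + c.im ^ 2 = 1 := by
    have h := Complex.normSq_apply c
    rw [Complex.normSq_eq_norm_sq, hc] at h
    nlinarith [h]
  rw [hap]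
  by_cases hpN : p ∣ N
  · -- bad prime of the level: the factor is `1 - c a / p`
    rw [if_pos hpN, zero_mul, zero_mul, add_zero]
    intro h0
    have hca : c * (a : ℂ) = p := by
      have h := congr_arg (fun z => (p : ℂ) * z) h0
      simp only [mul_sub, mul_one, mul_zero] at h
      rw [show (p : ℂ) * (c * (a : ℂ) * (p : ℂ)⁻¹) = c * a by field_simp] at h
      linear_combination -h
    have habs : |(a : ℝ)| = p := by
      have h := congr_arg norm hca
      rw [norm_mul, hc, one_mul, Complex.norm_intCast, Complex.norm_natCast] at h
      exact h
    have hlt := abs_LFunction_prime_lt_of_dvd_level hf hp hpN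
    rw [← ha, habs] at hlt
    exact lt_irrefl _ hlt
  · -- good prime of the level: the factor is `1 - c a / p + c² / p`
    rw [if_neg hpN]
    intro h0
    have key : (p : ℂ) - c * a + c ^ 2 = 0 := by
      have h := congr_arg (fun z => (p : ℂ) * z) h0
      simp only [mul_add, mul_sub, mul_one, mul_zero] at h
      rw [show (p : ℂ) * (c * (a : ℂ) * (p : ℂ)⁻¹) = c * a by field_simp,
        show (p : ℂ) * ((p : ℂ) * c ^ 2 * ((p : ℂ)⁻¹) ^ 2) = c ^ 2 by field_simp] at h
      linear_combination h
    have hre := congr_arg Complex.re key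
    have him := congr_arg Complex.im key
    simp only [Complex.add_re, Complex.sub_re, Complex.mul_re, Complex.natCast_re,
      Complex.natCast_im, Complex.intCast_re, Complex.intCast_im, Complex.zero_re, sq,
      Complex.add_im, Complex.sub_im, Complex.mul_im, Complex.zero_im, mul_zero, sub_zero]
      at hre him
    -- `him : Im c · (2 Re c − a) = 0`
    have him' : c.im * (2 * c.re - a) = 0 := by linear_combination him
    rcases mul_eq_zero.mp him' with h | h
    · -- `Im c = 0`: then `Re c = ±1`, `a Re c = p + 1`, `a² = (p + 1)² > 4p`
      have hre2 : c.re ^ 2 = 1 := by nlinarith [hxy, h]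
      have h1 : c.re * a = p + 1 := by nlinarith [hre, h, hre2]
      have h2 : (a : ℝ) ^ 2 = ((p : ℝ) + 1) ^ 2 := by
        have h3 : (c.re * a) ^ 2 = ((p : ℝ) + 1) ^ 2 := by rw [h1]
        nlinarith [h3, hre2]
      nlinarith [h2, ha2, hp2]
    · -- `a = 2 Re c`: then `p = Re c² + Im c² = 1`
      have h1 : (p : ℝ) = 1 := by nlinarith [hre, h, hxy]
      linarith [hp2]

end Nonvanishing

/-! ## 4. Continuations: the hypothesis `L(f, χ, 1) ≠ 0` is the same at every level -/

section Continuation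

open ModularForms

variable {N : ℕ} [NeZero N] {m M : ℕ} [NeZero M]

omit [NeZero N] in
/-- The product of removed Euler factors
`P(s) = ∏_{p ∈ S} (1 − χ(p) a_p p⁻ˢ + 𝟙_N(p) χ(p)² p · p⁻²ˢ)` is an entire function of `s`
(a polynomial in the `p⁻ˢ`). [folklore] -/
theorem differentiable_eulerFactors (f : CuspForm (Gamma0 N) 2) (χ : DirichletCharacter ℂ m)
    {S : Finset ℕ} (hS : ∀ p ∈ S, p.Prime) :
    Differentiable ℂ fun s : ℂ => ∏ p ∈ S,
      (1 - χ (p : ZMod m) * cuspCoeff f p * (p : ℂ) ^ (-s) +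
        (if p ∣ N then 0 else (p : ℂ)) * χ (p : ZMod m) ^ 2 * ((p : ℂ) ^ (-s)) ^ 2) := by
  have ht : ∀ p ∈ S, Differentiable ℂ fun s : ℂ => (p : ℂ) ^ (-s) := fun p hp =>
    differentiable_neg.const_cpow (Or.inl (Nat.cast_ne_zero.mpr (hS p hp).ne_zero))
  exact Differentiable.fun_finsetProd (𝕜 := ℂ) (u := S)
    (f := fun (p : ℕ) (s : ℂ) => 1 - χ (p : ZMod m) * cuspCoeff f p * (p : ℂ) ^ (-s) +
      (if p ∣ N then 0 else (p : ℂ)) * χ (p : ZMod m) ^ 2 * ((p : ℂ) ^ (-s)) ^ 2)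
    fun p hp => ((differentiable_const _).sub (((differentiable_const _).mul
      (differentiable_const _)).mul (ht p hp))).add
      (((differentiable_const _).mul (differentiable_const _)).mul ((ht p hp).pow 2))

/-- **The product of removed Euler factors is non-zero at `s = 1`** for the newform of an
elliptic curve over `ℚ` and primes not dividing the modulus of `χ` (`eulerFactor_one_ne_zero`
factor by factor; `|χ(p)| = 1` at such primes, Mathlib `DirichletCharacter.unit_norm_eq_one`).
[folklore] -/
theorem eulerFactors_one_ne_zero {W : WeierstrassCurve ℚ} [W.IsElliptic]
    {f : CuspForm (Gamma0 N) 2} (hf : IsNewformOf W f) (χ : DirichletCharacter ℂ m)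
    {S : Finset ℕ} (hS : ∀ p ∈ S, p.Prime ∧ ¬ p ∣ m) :
    ∏ p ∈ S, (1 - χ (p : ZMod m) * cuspCoeff f p * (p : ℂ) ^ (-(1 : ℂ)) +
      (if p ∣ N then 0 else (p : ℂ)) * χ (p : ZMod m) ^ 2 * ((p : ℂ) ^ (-(1 : ℂ))) ^ 2) ≠ 0 := by
  rw [Finset.prod_ne_zero_iff]
  intro p hp
  obtain ⟨hpP, hpm⟩ := hS p hp
  have hu : IsUnit (p : ZMod m) :=
    (ZMod.isUnit_iff_coprime p m).mpr ((Nat.Prime.coprime_iff_not_dvd hpP).mpr hpm)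
  have hc : ‖χ (p : ZMod m)‖ = 1 := by
    rw [← hu.unit_spec]
    exact χ.unit_norm_eq_one hu.unit
  rw [cpow_neg_one]
  exact eulerFactor_one_ne_zero hf hpP hc

/-- **Down the levels (any cusp form's newform structure suffices).** For a newform
`f ∈ S₂(Γ₀(N))`, `χ` mod `m` and `χ̃ = changeLevel χ` mod `M` (`m ∣ M`): if an entire
continuation of the mod-`M` series `∑ χ̃(n) aₙ n⁻ˢ` is non-zero at `s = 1`, then so is the entire
continuation of the mod-`m` series `∑ χ(n) aₙ n⁻ˢ` (which exists,
`exists_differentiable_eq_twistedLSeries_holds`): the former is the latter times the entire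
product of removed Euler factors (`twistedLSeries_changeLevel_eq_prod_mul` and the identity
theorem). [folklore] -/
theorem exists_continuation_of_changeLevel [NeZero m] {f : CuspForm (Gamma0 N) 2}
    (hf : IsNewform0 f) (hd : m ∣ M) (χ : DirichletCharacter ℂ m)
    (hL : ∃ L : ℂ → ℂ, Differentiable ℂ L ∧
      (∀ s : ℂ, 2 < s.re → L s = twistedLSeries f (DirichletCharacter.changeLevel hd χ) s) ∧
      L 1 ≠ 0) :
    ∃ L₀ : ℂ → ℂ, Differentiable ℂ L₀ ∧
      (∀ s : ℂ, 2 < s.re → L₀ s = twistedLSeries f χ s) ∧ L₀ 1 ≠ 0 := by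
  obtain ⟨L, hLd, hLs, hL1⟩ := hL
  obtain ⟨L₀, hL₀d, hL₀s⟩ := exists_differentiable_eq_twistedLSeries_holds f χ
  refine ⟨L₀, hL₀d, hL₀s, fun h0 => hL1 ?_⟩
  set S : Finset ℕ := M.primeFactors.filter (fun p => ¬ p ∣ m) with hSdef
  have hS : ∀ p ∈ S, p.Prime := fun p hp =>
    Nat.prime_of_mem_primeFactors (Finset.mem_filter.mp hp).1
  set P : ℂ → ℂ := fun s => ∏ p ∈ S,
    (1 - χ (p : ZMod m) * cuspCoeff f p * (p : ℂ) ^ (-s) +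
      (if p ∣ N then 0 else (p : ℂ)) * χ (p : ZMod m) ^ 2 * ((p : ℂ) ^ (-s)) ^ 2) with hP
  have hPd : Differentiable ℂ P := differentiable_eulerFactors f χ hS
  have hLP : L = fun s => P s * L₀ s := by
    refine AnalyticOnNhd.eq_of_eventuallyEq (z₀ := (3 : ℂ))
      (hLd.differentiableOn.analyticOnNhd isOpen_univ)
      ((hPd.mul hL₀d).differentiableOn.analyticOnNhd isOpen_univ) ?_
    have hopen : IsOpen {s : ℂ | 2 < s.re} := isOpen_lt continuous_const Complex.continuous_re
    have hmem : (3 : ℂ) ∈ {s : ℂ | 2 < s.re} := by simp; norm_num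
    filter_upwards [hopen.mem_nhds hmem] with s hs
    rw [hLs s hs, hL₀s s hs, twistedLSeries_changeLevel_eq_prod_mul hf hd χ hs]
  rw [hLP]
  simp [h0]

/-- **Up the levels (needs the non-vanishing of the removed Euler factors at `1`).** For the
newform `f` of an elliptic curve `E/ℚ` (`IsNewformOf W f`), `χ` mod `m` and
`χ̃ = changeLevel χ` mod `M` (`m ∣ M`): if an entire continuation `L₀` of the mod-`m` series is
non-zero at `1`, then `P · L₀`, `P` the product of the Euler factors at the primes of `M` not
dividing `m`, is an entire continuation of the mod-`M` series, non-zero at `1` by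
`eulerFactors_one_ne_zero`. [folklore] -/
theorem exists_continuation_changeLevel_of {W : WeierstrassCurve ℚ} [W.IsElliptic]
    {f : CuspForm (Gamma0 N) 2} (hf : IsNewformOf W f) (hd : m ∣ M) (χ : DirichletCharacter ℂ m)
    (hL : ∃ L₀ : ℂ → ℂ, Differentiable ℂ L₀ ∧
      (∀ s : ℂ, 2 < s.re → L₀ s = twistedLSeries f χ s) ∧ L₀ 1 ≠ 0) :
    ∃ L : ℂ → ℂ, Differentiable ℂ L ∧
      (∀ s : ℂ, 2 < s.re → L s = twistedLSeries f (DirichletCharacter.changeLevel hd χ) s) ∧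
      L 1 ≠ 0 := by
  obtain ⟨L₀, hL₀d, hL₀s, hL₀1⟩ := hL
  set S : Finset ℕ := M.primeFactors.filter (fun p => ¬ p ∣ m) with hSdef
  have hS : ∀ p ∈ S, p.Prime := fun p hp =>
    Nat.prime_of_mem_primeFactors (Finset.mem_filter.mp hp).1
  have hS' : ∀ p ∈ S, p.Prime ∧ ¬ p ∣ m := fun p hp =>
    ⟨hS p hp, (Finset.mem_filter.mp hp).2⟩
  set P : ℂ → ℂ := fun s => ∏ p ∈ S,
    (1 - χ (p : ZMod m) * cuspCoeff f p * (p : ℂ) ^ (-s) +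
      (if p ∣ N then 0 else (p : ℂ)) * χ (p : ZMod m) ^ 2 * ((p : ℂ) ^ (-s)) ^ 2) with hP
  have hPd : Differentiable ℂ P := differentiable_eulerFactors f χ hS
  have hP1 : P 1 ≠ 0 := eulerFactors_one_ne_zero hf χ hS'
  refine ⟨fun s => P s * L₀ s, hPd.mul hL₀d, fun s hs => ?_, mul_ne_zero hP1 hL₀1⟩
  change P s * L₀ s = _
  rw [hL₀s s hs, twistedLSeries_changeLevel_eq_prod_mul hf.1 hd χ hs]

/-- **Kato's hypothesis is level-independent.** For the newform `f` of an elliptic curve `E/ℚ`,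
a Dirichlet character `χ` mod `m` and its inflation `χ̃` mod `M` (`m ∣ M`), the mod-`M` series
`∑ χ̃(n) aₙ n⁻ˢ = L_{prime(M)}(f, χ, s)` has an entire continuation non-vanishing at `1` iff the
mod-`m` series `∑ χ(n) aₙ n⁻ˢ` has (Kato, Astérisque 295, p. 235 and §6.2: `L(f, χ, s)` means
`L_S(f, χ, s)`; the choice of the finite set `S ⊇ prime(cond χ)` is immaterial at `s = 1`).
[cite: Kato2004Asterisque, §14 Thm. 14.2 (p. 235)] -/
theorem exists_continuation_changeLevel_iff [NeZero m] {W : WeierstrassCurve ℚ} [W.IsElliptic]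
    {f : CuspForm (Gamma0 N) 2} (hf : IsNewformOf W f) (hd : m ∣ M)
    (χ : DirichletCharacter ℂ m) :
    (∃ L : ℂ → ℂ, Differentiable ℂ L ∧
      (∀ s : ℂ, 2 < s.re → L s = twistedLSeries f (DirichletCharacter.changeLevel hd χ) s) ∧
      L 1 ≠ 0) ↔
    ∃ L₀ : ℂ → ℂ, Differentiable ℂ L₀ ∧
      (∀ s : ℂ, 2 < s.re → L₀ s = twistedLSeries f χ s) ∧ L₀ 1 ≠ 0 :=
  ⟨exists_continuation_of_changeLevel hf.1 hd χ, exists_continuation_changeLevel_of hf hd χ⟩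

/-- **Kato's hypothesis in terms of the primitive twisted `L`-value.** For the newform `f` of an
elliptic curve `E/ℚ` and a Dirichlet character `χ` mod `M` with primitive character `χ₀`
(Mathlib `primitiveCharacter`, `changeLevel_primitiveCharacter`): the mod-`M` series
`∑ χ(n) aₙ n⁻ˢ` has an entire continuation non-vanishing at `1` iff the primitive twisted series
`L(f ⊗ χ₀, s) = ∑ χ₀(n) aₙ n⁻ˢ` has, i.e. iff `L(f ⊗ χ₀, 1) ≠ 0`. [folklore] -/
theorem exists_continuation_iff_primitive {W : WeierstrassCurve ℚ} [W.IsElliptic]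
    {f : CuspForm (Gamma0 N) 2} (hf : IsNewformOf W f) (χ : DirichletCharacter ℂ M) :
    (∃ L : ℂ → ℂ, Differentiable ℂ L ∧
      (∀ s : ℂ, 2 < s.re → L s = twistedLSeries f χ s) ∧ L 1 ≠ 0) ↔
    ∃ L₀ : ℂ → ℂ, Differentiable ℂ L₀ ∧
      (∀ s : ℂ, 2 < s.re → L₀ s = twistedLSeries f χ.primitiveCharacter s) ∧ L₀ 1 ≠ 0 := by
  haveI : NeZero χ.conductor := ⟨χ.conductor_ne_zero⟩
  have h := exists_continuation_changeLevel_iff hf χ.conductor_dvd_level χ.primitiveCharacter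
  rwa [DirichletCharacter.changeLevel_primitiveCharacter] at h

end Continuation

/-! ## 5. Kato's Cor. 14.3 (2) fed with lower-level or primitive `L`-values -/

section Kato

open ModularForms

/-- **Kato's Cor. 14.3 (2) over `ℚ(ζ_M)` from a LOWER-level `L`-value.** Assume the vendored
fact `kato_finite_chiPart_of_twistedLValue_ne_zero` (Kato, Astérisque 295, Cor. 14.3 (2), p. 235;
hypothesis `hK`, NOT proved in the tree). Let `E/ℚ` be an elliptic curve with newform `f`
(`IsNewformOf W f`), `m ∣ M`, `χ` a Dirichlet character mod `m` and `χ̃ = changeLevel χ` its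
inflation mod `M`, read on `Gal(ℚ(ζ_M)/ℚ) ≅ (ℤ/M)ˣ` (`cyclotomicCharacterOf`). If the mod-`m`
series `∑ χ(n) aₙ(f) n⁻ˢ` (e.g. the primitive `L(f ⊗ χ, s)` when `χ` is primitive) has an entire
continuation non-vanishing at `s = 1`, then the `χ̃`-part of `E(ℚ(ζ_M))` is finite: by
`exists_continuation_changeLevel_of` the mod-`M` series inherits the hypothesis, and the
all-moduli form `kato_finite_chiPart_cyclotomic_of_twistedLValue_ne_zero_of` of the fact applies.
[cite: Kato2004Asterisque, Cor. 14.3 (2) (p. 235)] -/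
theorem kato_finite_chiPart_changeLevel_of_twistedLValue_ne_zero
    (hK : kato_finite_chiPart_of_twistedLValue_ne_zero)
    (W : WeierstrassCurve ℚ) [W.IsElliptic] {N : ℕ} [NeZero N] {f : CuspForm (Gamma0 N) 2}
    (hf : IsNewformOf W f) {m M : ℕ} [NeZero M] [DecidableEq (CyclotomicField M ℚ)]
    (hd : m ∣ M) (χ : DirichletCharacter ℂ m)
    (hL : ∃ L₀ : ℂ → ℂ, Differentiable ℂ L₀ ∧
      (∀ s : ℂ, 2 < s.re → L₀ s = twistedLSeries f χ s) ∧ L₀ 1 ≠ 0) :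
    Finite (chiPart
      (fun σ : CyclotomicField M ℚ ≃ₐ[ℚ] CyclotomicField M ℚ =>
        Point.map (W' := W.toAffine) (σ : CyclotomicField M ℚ →ₐ[ℚ] CyclotomicField M ℚ))
      (fun σ => (cyclotomicCharacterOf (DirichletCharacter.changeLevel hd χ) σ : ℂ))) :=
  kato_finite_chiPart_cyclotomic_of_twistedLValue_ne_zero_of hK W hf
    (DirichletCharacter.changeLevel hd χ) (exists_continuation_changeLevel_of hf hd χ hL)

/-- **Kato's Cor. 14.3 (2) over `ℚ(ζ_M)` from the PRIMITIVE twisted `L`-value.** Assume the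
vendored fact `kato_finite_chiPart_of_twistedLValue_ne_zero` (hypothesis `hK`, NOT proved in the
tree). Let `E/ℚ` be an elliptic curve with newform `f`, `M ≥ 1`, and `χ` a Dirichlet character
mod `M` with primitive character `χ₀` mod `cond(χ)`. If `L(f ⊗ χ₀, 1) ≠ 0` — an entire
continuation of `∑ χ₀(n) aₙ(f) n⁻ˢ` (`re s > 2`) is non-zero at `1` — then the `χ`-part of
`E(ℚ(ζ_M))` is finite (`exists_continuation_iff_primitive` and the all-moduli form of the fact).
This is the form in which non-vanishing theorems for twisted `L`-values (Rohrlich and successors)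
feed Kato's corollary. [cite: Kato2004Asterisque, Cor. 14.3 (2) (p. 235)] -/
theorem kato_finite_chiPart_of_primitive_twistedLValue_ne_zero
    (hK : kato_finite_chiPart_of_twistedLValue_ne_zero)
    (W : WeierstrassCurve ℚ) [W.IsElliptic] {N : ℕ} [NeZero N] {f : CuspForm (Gamma0 N) 2}
    (hf : IsNewformOf W f) {M : ℕ} [NeZero M] [DecidableEq (CyclotomicField M ℚ)]
    (χ : DirichletCharacter ℂ M)
    (hL : ∃ L₀ : ℂ → ℂ, Differentiable ℂ L₀ ∧
      (∀ s : ℂ, 2 < s.re → L₀ s = twistedLSeries f χ.primitiveCharacter s) ∧ L₀ 1 ≠ 0) :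
    Finite (chiPart
      (fun σ : CyclotomicField M ℚ ≃ₐ[ℚ] CyclotomicField M ℚ =>
        Point.map (W' := W.toAffine) (σ : CyclotomicField M ℚ →ₐ[ℚ] CyclotomicField M ℚ))
      (fun σ => (cyclotomicCharacterOf χ σ : ℂ))) :=
  kato_finite_chiPart_cyclotomic_of_twistedLValue_ne_zero_of hK W hf χ
    ((exists_continuation_iff_primitive hf χ).mpr hL)

/-- **Kato's Cor. 14.3 (2) with an arbitrary finite set of removed Euler factors.** Assume the
vendored fact (hypothesis `hK`). Let `E/ℚ` be an elliptic curve with newform `f`, `χ` a Dirichlet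
character mod `M`, and `m'` ANY multiple of `M` (so `prime(m') ⊇ prime(M)` is any larger finite
set of primes `S`): if the series `L_S(f, χ, s) = ∑_{(n,m')=1} χ(n) aₙ n⁻ˢ` — the mod-`m'` series
of the inflation of `χ` — has an entire continuation non-vanishing at `1`, then the `χ`-part of
`E(ℚ(ζ_M))` is finite (`exists_continuation_of_changeLevel`: the smaller set of removed factors
inherits the hypothesis for free). Together with the previous theorems: Kato's hypothesis
"`L_S(E, χ, 1) ≠ 0`" may be checked with any finite `S ⊇ prime(cond χ)`.
[cite: Kato2004Asterisque, Cor. 14.3 (2) (p. 235)] -/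
theorem kato_finite_chiPart_of_twistedLValue_ne_zero_of_multiple
    (hK : kato_finite_chiPart_of_twistedLValue_ne_zero)
    (W : WeierstrassCurve ℚ) [W.IsElliptic] {N : ℕ} [NeZero N] {f : CuspForm (Gamma0 N) 2}
    (hf : IsNewformOf W f) {M m' : ℕ} [NeZero M] [NeZero m'] [DecidableEq (CyclotomicField M ℚ)]
    (hd : M ∣ m') (χ : DirichletCharacter ℂ M)
    (hL : ∃ L : ℂ → ℂ, Differentiable ℂ L ∧
      (∀ s : ℂ, 2 < s.re → L s = twistedLSeries f (DirichletCharacter.changeLevel hd χ) s) ∧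
      L 1 ≠ 0) :
    Finite (chiPart
      (fun σ : CyclotomicField M ℚ ≃ₐ[ℚ] CyclotomicField M ℚ =>
        Point.map (W' := W.toAffine) (σ : CyclotomicField M ℚ →ₐ[ℚ] CyclotomicField M ℚ))
      (fun σ => (cyclotomicCharacterOf χ σ : ℂ))) :=
  kato_finite_chiPart_cyclotomic_of_twistedLValue_ne_zero_of hK W hf χ
    (exists_continuation_of_changeLevel hf.1 hd χ hL)

end Kato

end Literature.NumberTheory.EllipticCurves

end
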